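import Summits.ValiantsHypothesis.ValiantsHypothesis.Theorems.ValuativeGCTValuativeBoundNegativeLoadBearing
import Literature.RingTheory.MvPolynomial.VanishingOnSubspace

/-!
# `ValuativeBound` (stmt-ValiantsHypothesis-12625), negative side VIII: the truncation `T_U` depends on
`U` only through its `Stab(det_m)`-saturation, and is antitone in `U` and in the threshold
(cdisprove, cycle 3 — bookkeeping the ValuativeFlip / CutBites seats can import)

* `truncation_rowLocus_le_comap` : for EVERY `M` with `det_m ∘ M = det_m` (invertible or not),
  `T_U ≤ T_{U·M⁻¹}` where `U·M⁻¹ = {u : u·M ∈ U}` (`Submodule.comap (vecMulLinear M)`): a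
  Stab-invariant `G` vanishing to order `t` along `L_U` vanishes to order `t` along `L_{U·M⁻¹}`
  because `G = G ∘ (A ↦ A·M)`.  Hence `T_U` is constant on `Stab`-orbits of `U` (only the
  equivalence class of the singular space matters: `Λ₃ ~ P·Λ₃·Q`), and replacing `U` by the span of
  its whole `Stab`-saturation can only SHRINK `T` — the useful `U` are the `Stab`-saturated ones.
* `truncation_antitone_locus` (`L ⊆ L' ⇒ T(L') ≤ T(L)`), `truncation_rowLocus_antitone`
  (`U ≤ U' ⇒ T_{U'} ≤ T_U`: maximal singular spaces of a given rank cut most),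
  `truncation_antitone_threshold` (`t ≤ t' ⇒ T(t') ≤ T(t)`). [folklore]
-/

namespace Summit.ValiantsHypothesis.Theorems.ValuativeBoundNegative

open MvPolynomial
open Literature.NumberTheory.DiophantineGeometry Literature.Computability.AlgebraicComplexity

section OrbitInvariance

variable {m : ℕ}

/-- The right substitution `G ↦ G ∘ (A ↦ A·M)` of the Stab clause, as an algebra map. -/
noncomputable def stabSubst (M : Matrix (MatIdx m) (MatIdx m) ℂ) :
    MvPolynomial (MatIdx m × MatIdx m) ℂ →ₐ[ℂ] MvPolynomial (MatIdx m × MatIdx m) ℂ :=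
  MvPolynomial.aeval fun p : MatIdx m × MatIdx m =>
    ∑ l : MatIdx m, M l p.2 • (X (p.1, l) : MvPolynomial (MatIdx m × MatIdx m) ℂ)

/-- `stabSubst M G` at the point `A` is `G` at `A·M` (`(A·M)(i, l') = ∑_l A(i, l) M(l, l')`). -/
theorem eval_stabSubst (M : Matrix (MatIdx m) (MatIdx m) ℂ) (A : MatIdx m × MatIdx m → ℂ)
    (G : MvPolynomial (MatIdx m × MatIdx m) ℂ) :
    eval A (stabSubst M G) = eval (fun p => ∑ l : MatIdx m, A (p.1, l) * M l p.2) G := by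
  have hfun : (fun p : MatIdx m × MatIdx m => eval A (∑ l : MatIdx m, M l p.2 •
      (X (p.1, l) : MvPolynomial (MatIdx m × MatIdx m) ℂ))) = fun p => ∑ l : MatIdx m, A (p.1, l) * M l p.2 := by
    funext p
    simp only [map_sum, smul_eval, eval_X]
    exact Finset.sum_congr rfl fun l _ => mul_comm _ _
  rw [stabSubst, Literature.RingTheory.MvPolynomial.eval_aeval_eq_eval, hfun]

/-- Stab-invariants are fixed by `stabSubst M`, `M ∈ Stab(det_m)`. -/
theorem stabSubst_eq_self_of_mem_stabInvariants {G : MvPolynomial (MatIdx m × MatIdx m) ℂ}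
    (hS : G ∈ stabInvariants m) {M : Matrix (MatIdx m) (MatIdx m) ℂ}
    (hM : linSubst (MatIdx m) ℂ M (detFormLex ℂ m) = detFormLex ℂ m) : stabSubst M G = G :=
  (mem_stabInvariants_iff.mp hS) M hM

/-- `A ↦ A·M` maps `L_{U·M⁻¹}` into `L_U`, where `U·M⁻¹ = comap (· ᵥ* M) U`. -/
theorem rowMul_mem_rowLocus {U : Submodule ℂ (MatIdx m → ℂ)} {M : Matrix (MatIdx m) (MatIdx m) ℂ}
    {A : MatIdx m × MatIdx m → ℂ} (hA : A ∈ rowLocus m (U.comap (Matrix.vecMulLinear M))) :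
    (fun p : MatIdx m × MatIdx m => ∑ l : MatIdx m, A (p.1, l) * M l p.2) ∈ rowLocus m U := by
  intro j
  have h := hA j
  rw [Submodule.mem_comap] at h
  exact h

/-- `stabSubst M` maps `I(L_U)` into `I(L_{U·M⁻¹})`. -/
theorem stabSubst_mem_vanishingIdeal {U : Submodule ℂ (MatIdx m → ℂ)} (M : Matrix (MatIdx m) (MatIdx m) ℂ)
    {G : MvPolynomial (MatIdx m × MatIdx m) ℂ} (hG : G ∈ MvPolynomial.vanishingIdeal ℂ (rowLocus m U)) :
    stabSubst M G ∈ MvPolynomial.vanishingIdeal ℂ (rowLocus m (U.comap (Matrix.vecMulLinear M))) := by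
  rw [MvPolynomial.mem_vanishingIdeal_iff] at hG ⊢
  intro A hA
  have h := hG _ (rowMul_mem_rowLocus hA)
  have e1 : MvPolynomial.aeval A (stabSubst M G) = eval A (stabSubst M G) := rfl
  have e2 : MvPolynomial.aeval (fun p : MatIdx m × MatIdx m => ∑ l : MatIdx m, A (p.1, l) * M l p.2) G =
      eval (fun p : MatIdx m × MatIdx m => ∑ l : MatIdx m, A (p.1, l) * M l p.2) G := rfl
  rw [e1, eval_stabSubst, ← e2]
  exact h

/-- … and hence `I(L_U)^t` into `I(L_{U·M⁻¹})^t`. -/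
theorem stabSubst_mem_vanishingIdeal_pow {U : Submodule ℂ (MatIdx m → ℂ)} (M : Matrix (MatIdx m) (MatIdx m) ℂ)
    {t : ℕ} {G : MvPolynomial (MatIdx m × MatIdx m) ℂ}
    (hG : G ∈ (MvPolynomial.vanishingIdeal ℂ (rowLocus m U)) ^ t) :
    stabSubst M G ∈ (MvPolynomial.vanishingIdeal ℂ (rowLocus m (U.comap (Matrix.vecMulLinear M)))) ^ t := by
  have h1 : stabSubst M G ∈ ((MvPolynomial.vanishingIdeal ℂ (rowLocus m U)) ^ t).map (stabSubst M) :=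
    Ideal.mem_map_of_mem _ hG
  rw [Ideal.map_pow] at h1
  refine Ideal.pow_right_mono ?_ t h1
  rw [Ideal.map_le_iff_le_comap]
  intro G' hG'
  exact stabSubst_mem_vanishingIdeal M hG'

/-- **`T_U ≤ T_{U·M⁻¹}` for every `M ∈ Stab(det_m)`** (invertible or not): the truncation sees `U`
only through its `Stab`-saturation. -/
theorem truncation_rowLocus_le_comap (U : Submodule ℂ (MatIdx m → ℂ)) {M : Matrix (MatIdx m) (MatIdx m) ℂ}
    (hM : linSubst (MatIdx m) ℂ M (detFormLex ℂ m) = detFormLex ℂ m) (t n : ℕ) (χ : Weight (MatIdx m)) :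
    truncation m (rowLocus m U) t n χ ≤
      truncation m (rowLocus m (U.comap (Matrix.vecMulLinear M))) t n χ := by
  intro G hG
  rw [mem_truncation_iff] at hG ⊢
  obtain ⟨hH, hV, hS, hB⟩ := hG
  refine ⟨hH, ?_, hS, hB⟩
  have h := stabSubst_mem_vanishingIdeal_pow M hV
  rwa [stabSubst_eq_self_of_mem_stabInvariants hS hM] at h

/-- **`T` is antitone in the locus.** -/
theorem truncation_antitone_locus {L L' : Set (MatIdx m × MatIdx m → ℂ)} (h : L ⊆ L') (t n : ℕ)
    (χ : Weight (MatIdx m)) : truncation m L' t n χ ≤ truncation m L t n χ := by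
  intro G hG
  rw [mem_truncation_iff] at hG ⊢
  obtain ⟨hH, hV, hS, hB⟩ := hG
  exact ⟨hH, Ideal.pow_right_mono (MvPolynomial.vanishingIdeal_anti_mono h) t hV, hS, hB⟩

/-- `U ≤ U' ⇒ L_U ⊆ L_{U'}`. -/
theorem rowLocus_mono {U U' : Submodule ℂ (MatIdx m → ℂ)} (h : U ≤ U') : rowLocus m U ⊆ rowLocus m U' :=
  fun _ hA j => h (hA j)

/-- **`T_U` is antitone in `U`**: bigger singular spaces (of the same rank bound) cut more, so only
MAXIMAL singular spaces of each rank matter. -/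
theorem truncation_rowLocus_antitone {U U' : Submodule ℂ (MatIdx m → ℂ)} (h : U ≤ U') (t n : ℕ)
    (χ : Weight (MatIdx m)) : truncation m (rowLocus m U') t n χ ≤ truncation m (rowLocus m U) t n χ :=
  truncation_antitone_locus (rowLocus_mono h) t n χ

/-- **`T` is antitone in the threshold.** -/
theorem truncation_antitone_threshold (L : Set (MatIdx m × MatIdx m → ℂ)) {t t' : ℕ} (h : t ≤ t') (n : ℕ)
    (χ : Weight (MatIdx m)) : truncation m L t' n χ ≤ truncation m L t n χ := by
  intro G hG
  rw [mem_truncation_iff] at hG ⊢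
  obtain ⟨hH, hV, hS, hB⟩ := hG
  exact ⟨hH, Ideal.pow_le_pow_right h hV, hS, hB⟩

end OrbitInvariance

end Summit.ValiantsHypothesis.Theorems.ValuativeBoundNegative
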